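import Mathlib
import HarnessLib
import Summits.Parity.BatemanHorn.Theses.AlmostPrimeZeros

/-!
# Route `AlmostPrimeZeros`, crux `SystemMomentDeficit` (stmt-Parity-11326), line `Sketch`
# (idea `small-circle-jensen`): the bookkeeping edge `DiscMajorantLog → K1`
# (`stub_smallCircle_of_discMajorantLog`)

Let `S_x(z) = Σ_{0 ≤ n ≤ x} z^{s_f(n)}` be the almost-prime polynomial of a Bateman–Horn system `f`
(`s_f(n) = Σ_i Σ_{p^v ∥ f_i(n)} min(v, 2)`, so `S_x(1) = x + 1`).  The rank-8 route item
`DiscMajorantLog` is the pointwise majorant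
`‖S_x(z)‖ ≤ A x (log x)^{k(Re z − 1)} e^{C‖z−1‖ log(‖z−1‖+2)}` on the disc `‖z − 1‖ ≤ 3 log log x`
for `x ≥ x₀`.  The core hypothesis K1 of the line only asks, for each large `x`, for ONE circle
`‖z − 1‖ = r` and ONE real tilt `a` such that the angular mean of
`log⁺ ‖S_x(z) e^{−a(z−1)} / (x+1)‖` over that circle is bounded by a constant.

Proof of the edge.  Take `r = 1`, `a = k log log x` and `x ≥ max x₀ 16`.  For `x ≥ 16` one has
`log log x ≥ 1`, so the circle `‖z − 1‖ = 1` lies in the disc of the majorant.  On it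
`‖e^{−a(z−1)}‖ = e^{−k log log x · (Re z − 1)} = (log x)^{−k(Re z − 1)}` cancels the harmonic
exponent of the majorant exactly, `x/(x+1) ≤ 1` and `C · 1 · log 3 ≤ (max C 0) log 3`, whence
`‖S_x(z) e^{−a(z−1)}/(x+1)‖ ≤ (max A 1) · 3^{max C 0} =: B ≥ 1` pointwise, so
`log⁺ ‖…‖ ≤ log B = log (max A 1) + (max C 0) log 3` pointwise on the circle, and the circle average
of a circle-integrable function bounded by a constant on the circle is bounded by that constant
(`Real.circleAverage_mono_on_of_le_circle`; integrability of `log⁺ ‖G‖` for the entire function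
`G` is `MeromorphicOn.circleIntegrable_posLog_norm`).

No number theory is used: the Bateman–Horn hypothesis is only passed to `DiscMajorantLog`.
-/

noncomputable section

namespace Summit.Parity.BatemanHorn.Cruxes.SystemMomentDeficit.SmallCircle

open Summit.Parity.BatemanHorn.Theses.AlmostPrimeZeros

/-- `1 ≤ log log x` for `x ≥ 16`: `log 16 = 4 log 2 > 2.77 > e`. -/
private theorem one_le_loglog_of_sixteen_le {x : ℝ} (hx : 16 ≤ x) :
    1 ≤ Real.log (Real.log x) := by
  -- adapted from Theorems/AlmostPrimeZerosSystemZeroRepulsionNearZone.lean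
  have h16 : Real.log 16 = 4 * Real.log 2 := by
    rw [show (16 : ℝ) = 2 ^ 4 by norm_num, Real.log_pow]
    norm_num
  have hlog2 := Real.log_two_gt_d9
  have he := Real.exp_one_lt_d9
  have h1 : Real.exp 1 ≤ Real.log x := by
    have : Real.log 16 ≤ Real.log x := Real.log_le_log (by norm_num) hx
    linarith
  calc (1 : ℝ) = Real.log (Real.exp 1) := (Real.log_exp 1).symm
    _ ≤ Real.log (Real.log x) := Real.log_le_log (Real.exp_pos 1) h1

/-- The real-variable bookkeeping of the edge on the circle `‖z − 1‖ = 1`: if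
`s ≤ A X ℓ^{κ(σ−1)} e^{C · 1 · log(1+2)}` with `X ≥ 0`, `ℓ > 0`, then
`s e^{−κ log ℓ (σ−1)} / (X+1) ≤ (max A 1) e^{(max C 0) log 3}`, because
`ℓ^{κ(σ−1)} e^{−κ log ℓ (σ−1)} = 1`, `X/(X+1) ≤ 1`, `A ≤ max A 1` and
`C log 3 ≤ (max C 0) log 3`. -/
private theorem tilted_norm_le_of_majorant {A C s X ℓ κ σ : ℝ} (hX : 0 ≤ X) (hℓ : 0 < ℓ)
    (hs : s ≤ A * X * ℓ ^ (κ * (σ - 1)) * Real.exp (C * 1 * Real.log (1 + 2))) :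
    s * Real.exp (-(κ * Real.log ℓ * (σ - 1))) / (X + 1) ≤
      max A 1 * Real.exp (max C 0 * Real.log 3) := by
  have hY : ℓ ^ (κ * (σ - 1)) = Real.exp (Real.log ℓ * (κ * (σ - 1))) := Real.rpow_def_of_pos hℓ _
  have hPQ : ℓ ^ (κ * (σ - 1)) * Real.exp (-(κ * Real.log ℓ * (σ - 1))) = 1 := by
    rw [hY, ← Real.exp_add,
      show Real.log ℓ * (κ * (σ - 1)) + -(κ * Real.log ℓ * (σ - 1)) = 0 by ring, Real.exp_zero]
  have hX1 : 0 < X + 1 := by linarith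
  have h3 : C * 1 * Real.log (1 + 2) ≤ max C 0 * Real.log 3 := by
    rw [mul_one, show (1 : ℝ) + 2 = 3 by norm_num]
    exact mul_le_mul_of_nonneg_right (le_max_left C 0) (Real.log_nonneg (by norm_num))
  have hE : Real.exp (C * 1 * Real.log (1 + 2)) ≤ Real.exp (max C 0 * Real.log 3) :=
    Real.exp_le_exp.2 h3
  have hA1 : 0 ≤ max A 1 := le_trans zero_le_one (le_max_right A 1)
  rw [div_le_iff₀ hX1]
  calc s * Real.exp (-(κ * Real.log ℓ * (σ - 1)))
      ≤ A * X * ℓ ^ (κ * (σ - 1)) * Real.exp (C * 1 * Real.log (1 + 2)) *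
          Real.exp (-(κ * Real.log ℓ * (σ - 1))) :=
        mul_le_mul_of_nonneg_right hs (Real.exp_pos _).le
    _ = A * (X * Real.exp (C * 1 * Real.log (1 + 2))) *
          (ℓ ^ (κ * (σ - 1)) * Real.exp (-(κ * Real.log ℓ * (σ - 1)))) := by ring
    _ = A * (X * Real.exp (C * 1 * Real.log (1 + 2))) := by rw [hPQ, mul_one]
    _ ≤ max A 1 * (X * Real.exp (C * 1 * Real.log (1 + 2))) :=
        mul_le_mul_of_nonneg_right (le_max_left A 1) (by positivity)
    _ ≤ max A 1 * ((X + 1) * Real.exp (max C 0 * Real.log 3)) :=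
        mul_le_mul_of_nonneg_left (mul_le_mul (by linarith) hE (Real.exp_pos _).le hX1.le) hA1
    _ = max A 1 * Real.exp (max C 0 * Real.log 3) * (X + 1) := by ring

/-- `log⁺ ((max A 1) e^{(max C 0) log 3}) = log (max A 1) + (max C 0) log 3`, the argument being
at least `1`. -/
private theorem posLog_bound_eq (A C : ℝ) :
    Real.posLog (max A 1 * Real.exp (max C 0 * Real.log 3)) =
      Real.log (max A 1) + max C 0 * Real.log 3 := by
  have hA1 : 0 < max A 1 := lt_of_lt_of_le one_pos (le_max_right A 1)
  have h1 : 1 ≤ Real.exp (max C 0 * Real.log 3) :=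
    Real.one_le_exp (mul_nonneg (le_max_right C 0) (Real.log_nonneg (by norm_num)))
  have hB1 : 1 ≤ max A 1 * Real.exp (max C 0 * Real.log 3) := by
    nlinarith [le_max_right A 1]
  have hB0 : 0 < max A 1 * Real.exp (max C 0 * Real.log 3) := by positivity
  rw [Real.posLog_eq_log (by rwa [abs_of_pos hB0]), Real.log_mul hA1.ne' (Real.exp_pos _).ne',
    Real.log_exp]

/-- **Bookkeeping edge `DiscMajorantLog → K1`.**  The rank-8 disc majorant
`‖S_x(z)‖ ≤ A x (log x)^{k(Re z−1)} e^{C‖z−1‖ log(‖z−1‖+2)}` on `‖z − 1‖ ≤ 3 log log x` (`x ≥ x₀`)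
gives, on the circle `‖z − 1‖ = 1 ⊂ {‖z−1‖ ≤ 3 log log x}` (`x ≥ 16`) and with the tilt
`a = k log log x` (`‖e^{−a(z−1)}‖ = (log x)^{−k(Re z−1)}`),
`‖S_x(z) e^{−a(z−1)}/(x+1)‖ ≤ max A 1 · 3^{max C 0}` pointwise, hence the angular mean of `log⁺` is
at most `log (max A 1) + (max C 0) log 3`: K1 holds with `r = 1`, this constant, and
`x₀' = max x₀ 16`. -/
theorem stub_smallCircle_of_discMajorantLog :
    DiscMajorantLog →
    ∀ (k : ℕ) (f : Fin k → Polynomial ℤ), Literature.NumberTheory.Sieve.IsBatemanHornSystem f →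
      ∃ r A : ℝ, ∃ x₀ : ℕ, 0 < r ∧ 0 ≤ A ∧ ∀ x : ℕ, x₀ ≤ x → ∃ a : ℝ,
        Real.circleAverage (fun z : ℂ => Real.posLog
          ‖(∑ n ∈ Finset.range (x + 1),
              z ^ (∑ i, (((f i).eval (n : ℤ)).toNat.factorization.sum fun _ v => min v 2))) *
            Complex.exp (-((a : ℂ) * (z - 1))) / ((x : ℂ) + 1)‖) 1 r ≤ A := by
  intro hD k f hf
  obtain ⟨A, C, x₀, h⟩ := hD k f hf
  have hA' : 0 ≤ Real.log (max A 1) + max C 0 * Real.log 3 :=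
    add_nonneg (Real.log_nonneg (le_max_right A 1))
      (mul_nonneg (le_max_right C 0) (Real.log_nonneg (by norm_num)))
  refine ⟨1, Real.log (max A 1) + max C 0 * Real.log 3, max x₀ 16, one_pos, hA', fun x hx =>
    ⟨(k : ℝ) * Real.log (Real.log (x : ℝ)), ?_⟩⟩
  have hx₀ : x₀ ≤ x := le_of_max_le_left hx
  have hx16 : (16 : ℝ) ≤ x := by exact_mod_cast le_of_max_le_right hx
  have hL1 : 1 ≤ Real.log (Real.log (x : ℝ)) := one_le_loglog_of_sixteen_le hx16
  have hlogx : 0 < Real.log (x : ℝ) := Real.log_pos (by linarith)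
  apply Real.circleAverage_mono_on_of_le_circle
  · -- `log⁺ ‖G‖` is circle integrable for the entire function `G`
    apply MeromorphicOn.circleIntegrable_posLog_norm
    intro z _
    apply AnalyticAt.meromorphicAt
    apply Differentiable.analyticAt
    fun_prop
  · intro z hz
    rw [Metric.mem_sphere, dist_eq_norm, abs_one] at hz
    have hmaj := h x hx₀ z (by rw [hz]; linarith)
    rw [hz] at hmaj
    have hN : ‖(x : ℂ) + 1‖ = (x : ℝ) + 1 := by exact_mod_cast Complex.norm_natCast (x + 1)
    rw [norm_div, norm_mul, Complex.norm_exp, hN]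
    simp only [Complex.neg_re, Complex.re_ofReal_mul, Complex.sub_re, Complex.one_re]
    have hB := tilted_norm_le_of_majorant (Nat.cast_nonneg x) hlogx hmaj
    rw [← posLog_bound_eq A C]
    exact Real.posLog_le_posLog (by positivity) hB

end Summit.Parity.BatemanHorn.Cruxes.SystemMomentDeficit.SmallCircle

end
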